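import Literature.MathematicalPhysics.QuantumLattice.SchwartzTranslationCutoff
import Literature.MathematicalPhysics.QuantumFieldTheory.OSSkeletonExplicitBounds
import Literature.MathematicalPhysics.QuantumLattice.SchwartzTensor
import HarnessLib

/-!
# Stub `stub_compactOfDisjoint` (N2a) of line `Sketch`, crux `WeakCouplingHypercubicLimit` (reshape r15)

Helper file for crux `stmt-QuantumFields-16120` (`PencilRigidity.WeakCouplingHypercubicLimit`), line `Sketch`.
Reshape r15 states the non-Gaussianity floor of the RP core in pairwise-disjoint geometry; the glue then
localises the three continuum test functions.  This file is the first localisation step, pure functional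
analysis on the Schwartz space: if the third-cumulant combination
`κ(f, g, h) = S3(f⊗g⊗h) − S1(f) S2(g⊗h) − S1(g) S2(f⊗h) − S1(h) S2(f⊗g) + 2 S1(f) S1(g) S1(h)` of a
Schwinger family `S₁` (continuous linear functionals on `𝓢((Fin n → ℝ⁴), ℂ)`, tensor witnesses
`SchwartzMap.tensorFin`) is non-zero on Schwartz `f, g, h`, then it is non-zero on COMPACTLY SUPPORTED
Schwartz `f', g', h'` with `tsupport f' ⊆ tsupport f`, `tsupport g' ⊆ tsupport g`, `tsupport h' ⊆ tsupport h`
(so pairwise disjointness of supports is inherited).  Proof: `κ` is separately continuous in each slot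
(`continuous_tensorFin`, continuity of `S₁ n`, continuity of `u ↦ ![u, g, h]`), and every Schwartz function is
the limit of its bump cut-offs, which are compactly supported inside its own support
(`exists_tsupport_subset_inter_closedBall_tendsto`); a non-zero value of a continuous function persists along
a convergent sequence, one slot at a time.
-/

noncomputable section

open scoped SchwartzMap
open MeasureTheory Filter Topology
open Literature.MathematicalPhysics.QuantumLattice
open Literature.MathematicalPhysics.QuantumFieldTheory

namespace Summit.QuantumFields.YangMills.Theorems.WeakCouplingHypercubicLimit.TraceNormColdPressure

/-- **Compact cut-off in one slot.** If a continuous function `Φ` on the Schwartz space of a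
finite-dimensional space does not vanish at `u`, then it does not vanish at some compactly supported Schwartz
function supported inside `tsupport u`: the bump cut-offs of `u` converge to `u` in `𝓢` and are supported in
`tsupport u ∩ closedBall 0 (2(m+1))` (Hörmander I, Lemma 7.1.8). [folklore] -/
theorem exists_hasCompactSupport_tsupport_subset_ne_zero {E : Type*} [NormedAddCommGroup E]
    [NormedSpace ℝ E] [FiniteDimensional ℝ E] {Φ : 𝓢(E, ℂ) → ℂ} (hΦ : Continuous Φ) {u : 𝓢(E, ℂ)}
    (hu : Φ u ≠ 0) :
    ∃ u' : 𝓢(E, ℂ), HasCompactSupport (u' : E → ℂ) ∧ tsupport (u' : E → ℂ) ⊆ tsupport (u : E → ℂ) ∧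
      Φ u' ≠ 0 := by
  haveI : ProperSpace E := FiniteDimensional.proper ℝ E
  obtain ⟨v, hv, hT⟩ := exists_tsupport_subset_inter_closedBall_tendsto u
  obtain ⟨m, hm⟩ := (((hΦ.tendsto u).comp hT).eventually_ne hu).exists
  exact ⟨v m, IsCompact.of_isClosed_subset (isCompact_closedBall _ _) (isClosed_tsupport _)
    ((hv m).trans Set.inter_subset_right), (hv m).trans Set.inter_subset_left, hm⟩

/-- **Stub N2a (compact cut-offs keep the third cumulant non-zero).**  For a Schwinger family `S₁` on `ℝ⁴`
and Schwartz `f, g, h` (with pairwise disjoint supports) on which the third-cumulant combination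
`S3(f⊗g⊗h) − S1(f) S2(g⊗h) − S1(g) S2(f⊗h) − S1(h) S2(f⊗g) + 2 S1(f) S1(g) S1(h)` (tensor witnesses
`SchwartzMap.tensorFin`) is non-zero, there are compactly supported Schwartz `f', g', h'` supported inside
`tsupport f, tsupport g, tsupport h` respectively on which it is still non-zero: the combination is continuous
in each slot separately and compactly supported cut-offs are sequentially dense below each function.
[folklore] -/
theorem stub_compactOfDisjoint :
    ∀ (S₁ : SchwingerFamily (EuclideanSpace ℝ (Fin 4))) (f g h : 𝓢(EuclideanSpace ℝ (Fin 4), ℂ)),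
      Disjoint (tsupport (f : EuclideanSpace ℝ (Fin 4) → ℂ)) (tsupport (g : EuclideanSpace ℝ (Fin 4) → ℂ)) →
      Disjoint (tsupport (f : EuclideanSpace ℝ (Fin 4) → ℂ)) (tsupport (h : EuclideanSpace ℝ (Fin 4) → ℂ)) →
      Disjoint (tsupport (g : EuclideanSpace ℝ (Fin 4) → ℂ)) (tsupport (h : EuclideanSpace ℝ (Fin 4) → ℂ)) →
      S₁ 3 (SchwartzMap.tensorFin 3 ![f, g, h]) -
            S₁ 1 (SchwartzMap.tensorFin 1 ![f]) * S₁ 2 (SchwartzMap.tensorFin 2 ![g, h]) -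
          S₁ 1 (SchwartzMap.tensorFin 1 ![g]) * S₁ 2 (SchwartzMap.tensorFin 2 ![f, h]) -
          S₁ 1 (SchwartzMap.tensorFin 1 ![h]) * S₁ 2 (SchwartzMap.tensorFin 2 ![f, g]) +
          2 * (S₁ 1 (SchwartzMap.tensorFin 1 ![f]) * S₁ 1 (SchwartzMap.tensorFin 1 ![g]) *
            S₁ 1 (SchwartzMap.tensorFin 1 ![h])) ≠ 0 →
      ∃ (f' g' h' : 𝓢(EuclideanSpace ℝ (Fin 4), ℂ)),
        HasCompactSupport (f' : EuclideanSpace ℝ (Fin 4) → ℂ) ∧ HasCompactSupport (g' : EuclideanSpace ℝ (Fin 4) → ℂ) ∧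
        HasCompactSupport (h' : EuclideanSpace ℝ (Fin 4) → ℂ) ∧
        tsupport (f' : EuclideanSpace ℝ (Fin 4) → ℂ) ⊆ tsupport (f : EuclideanSpace ℝ (Fin 4) → ℂ) ∧
        tsupport (g' : EuclideanSpace ℝ (Fin 4) → ℂ) ⊆ tsupport (g : EuclideanSpace ℝ (Fin 4) → ℂ) ∧
        tsupport (h' : EuclideanSpace ℝ (Fin 4) → ℂ) ⊆ tsupport (h : EuclideanSpace ℝ (Fin 4) → ℂ) ∧
        S₁ 3 (SchwartzMap.tensorFin 3 ![f', g', h']) -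
            S₁ 1 (SchwartzMap.tensorFin 1 ![f']) * S₁ 2 (SchwartzMap.tensorFin 2 ![g', h']) -
          S₁ 1 (SchwartzMap.tensorFin 1 ![g']) * S₁ 2 (SchwartzMap.tensorFin 2 ![f', h']) -
          S₁ 1 (SchwartzMap.tensorFin 1 ![h']) * S₁ 2 (SchwartzMap.tensorFin 2 ![f', g']) +
          2 * (S₁ 1 (SchwartzMap.tensorFin 1 ![f']) * S₁ 1 (SchwartzMap.tensorFin 1 ![g']) *
            S₁ 1 (SchwartzMap.tensorFin 1 ![h'])) ≠ 0 := by
  intro S₁ f g h _ _ _ hκ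
  -- the cumulant combination as a function of the three slots
  set κ : 𝓢(EuclideanSpace ℝ (Fin 4), ℂ) → 𝓢(EuclideanSpace ℝ (Fin 4), ℂ) →
      𝓢(EuclideanSpace ℝ (Fin 4), ℂ) → ℂ := fun u v w =>
    S₁ 3 (SchwartzMap.tensorFin 3 ![u, v, w]) -
          S₁ 1 (SchwartzMap.tensorFin 1 ![u]) * S₁ 2 (SchwartzMap.tensorFin 2 ![v, w]) -
        S₁ 1 (SchwartzMap.tensorFin 1 ![v]) * S₁ 2 (SchwartzMap.tensorFin 2 ![u, w]) -
        S₁ 1 (SchwartzMap.tensorFin 1 ![w]) * S₁ 2 (SchwartzMap.tensorFin 2 ![u, v]) +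
        2 * (S₁ 1 (SchwartzMap.tensorFin 1 ![u]) * S₁ 1 (SchwartzMap.tensorFin 1 ![v]) *
          S₁ 1 (SchwartzMap.tensorFin 1 ![w])) with hκ_def
  -- continuity of `tensorFin n` in the profiles (used by `fun_prop` below)
  have htf : ∀ n : ℕ, Continuous fun φ : Fin n → 𝓢(EuclideanSpace ℝ (Fin 4), ℂ) =>
      SchwartzMap.tensorFin n φ := continuous_tensorFin
  -- separate continuity in the three slots
  have h1 : ∀ v w, Continuous fun u => κ u v w := by
    intro v w
    simp only [hκ_def]
    fun_prop
  have h2 : ∀ u w, Continuous fun v => κ u v w := by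
    intro u w
    simp only [hκ_def]
    fun_prop
  have h3 : ∀ u v, Continuous fun w => κ u v w := by
    intro u v
    simp only [hκ_def]
    fun_prop
  change κ f g h ≠ 0 at hκ
  obtain ⟨f', hf'c, hf's, hf'⟩ := exists_hasCompactSupport_tsupport_subset_ne_zero (h1 g h) hκ
  obtain ⟨g', hg'c, hg's, hg'⟩ :=
    exists_hasCompactSupport_tsupport_subset_ne_zero (h2 f' h) (show (fun v => κ f' v h) g ≠ 0 from hf')
  obtain ⟨h', hh'c, hh's, hh'⟩ :=
    exists_hasCompactSupport_tsupport_subset_ne_zero (h3 f' g') (show (fun w => κ f' g' w) h ≠ 0 from hg')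
  exact ⟨f', g', h', hf'c, hg'c, hh'c, hf's, hg's, hh's, hh'⟩

end Summit.QuantumFields.YangMills.Theorems.WeakCouplingHypercubicLimit.TraceNormColdPressure
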